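import Mathlib
import Literature.Analysis.FluidPDE.NSKatoToClayHolds
import Literature.Analysis.FluidPDE.NSFourierAPriori
import HarnessLib

/-!
# Crux `FrozenSignCascade.EnvelopeBound` (stmt-NavierStokesRegularity-1549), line `registered`,
  stub `stub_energyOfUnique`: uniqueness ⇒ the energy inequality of Fourier-side mild solutions

Helper file for the crux item stmt-NavierStokesRegularity-1549 (`EnvelopeBound` of route
`FrozenSignCascade`); lands `--supports` that item.

**Statement (`stub_energyOfUnique`).** Assume uniqueness in the Fourier-mild class on `ℝ³`
(two `IsFourierMild c K₀ t₀ T V`, `IsFourierMild c K₀ t₀ T' W` with `V t₀ = W t₀` agree on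
`[t₀, min T T']`). Then for every Fourier-side mild solution `V` on `[t₀, t₁]`
(`IsFourierMild c K₀ t₀ t₁ V`) the Fourier-side energy `E(t) = ∫ ∑ₗ ‖V(t, η)ₗ‖² dη` satisfies
`E(t) ≤ E(t₀)` for `t ∈ [t₀, t₁]` (Leray 1934, (2.7)/(3.4); Lemarié-Rieusset 2016, Thm. 7.2 and
Prop. 12.1: mild solutions with this much decay are Leray solutions and satisfy the energy
inequality).

**Proof (route through the tree; every ingredient is proved).**
1. `K₀` enters `IsFourierMild` only through `card ι < K₀`, so `V` is also mild of order `4`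
   (`isFourierMild_four`); the order-`4` weight `A` of `V(t)` is uniform in `t` (field `decay`),
   hence Picard's time `T_P = picardTime (4π²ν) 4 (2A)`, `ν = c/(4π²)`, is uniform.
2. *Window step* (`lintegral_energy_le_of_window`): for `s ∈ [t₀, t₁]` restart the Fourier–Picard
   construction from `V s` (`exists_isTaoSolutionOn_fourierPiece`): a Tao-class solution `(u, p)`
   on `[0, T_P]` from `synthVel (V s)` with Fourier side `W`, `u τ = synthVel (W τ)`, `W 0 = V s`.
   By the uniqueness hypothesis (after `IsFourierMild.mono`/`translate`) `V (τ + s) = W τ` on the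
   window, so by Plancherel (`lintegral_norm_synthVel_sq_eq`) and the Leray–Hopf energy inequality
   of Tao-class solutions (`IsTaoSolutionOn.lintegral_enorm_sq_le`, `eEnergy_eq_ofReal`)
   `E(t) = ‖u(t - s)‖²_{L²} ≤ ‖synthVel (V s)‖²_{L²} = E(s)` for `s ≤ t ≤ min t₁ (s + T_P)`
   (in `ℝ≥0∞`).
3. *Chain* (`le_init_of_windows`): induction over the windows `[t₀ + n T_P, t₀ + (n+1) T_P]`.
4. *Conversion* to the real Bochner integrals of the statement
   (`integral_sum_norm_sq_eq_toReal`, `lintegral_sum_enorm_sq_lt_top`; the integrand is continuous,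
   nonnegative and integrable by `integrable_norm_sq_of_hasDecay`).

The direct Fourier-side proof (`∂ₜV = -c‖ξ‖²V - N(V,V)` and the trilinear cancellation by
`divFree`/`conjSymm`) is deliberately NOT here.
-/

noncomputable section

set_option linter.dupNamespace false -- nested layout Summit.<S>.<Sub>, Sub = S (D-0017)

open MeasureTheory Set Real Filter
open scoped ENNReal ComplexConjugate
open Literature.Analysis.FluidPDE Literature.Analysis.FluidPDE.FourierNS

namespace Summit.NavierStokesRegularity.NavierStokesRegularity.Theorems.EnvelopeBound.Registered

variable {c t₀ t₁ : ℝ} {K₀ : ℕ} {V : ℝ → EuclideanSpace ℝ (Fin 3) → Fin 3 → ℂ}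

/-! ### Order `4` and the real / extended energies -/

/-- On `ℝ³` a Fourier-side mild solution of any weight order `K₀` is one of order `4`: the order
enters `IsFourierMild` only through `card (Fin 3) < K₀`, all other fields (in particular the decay
of *every* polynomial order, uniformly in time) being independent of it. -/
theorem isFourierMild_four (h : IsFourierMild c K₀ t₀ t₁ V) : IsFourierMild c 4 t₀ t₁ V where
  hc := h.hc
  hK₀ := by simp
  le := h.le
  cont := h.cont
  decay := h.decay
  duhamel := h.duhamel
  divFree := h.divFree
  conjSymm := h.conjSymm

/-- The extended Fourier energy `∫⁻ ∑ₗ ‖V(r, η)ₗ‖ₑ²` is the `ofReal`-lintegral of the real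
integrand `∑ₗ ‖V(r, η)ₗ‖²`. -/
theorem lintegral_ofReal_sum_norm_sq (r : ℝ) :
    ∫⁻ η, ENNReal.ofReal (∑ l, ‖V r η l‖ ^ 2) = ∫⁻ η, ∑ l, ‖V r η l‖ₑ ^ 2 := by
  refine lintegral_congr fun η => ?_
  rw [ENNReal.ofReal_sum_of_nonneg fun l _ => sq_nonneg _]
  refine Finset.sum_congr rfl fun l _ => ?_
  rw [← ofReal_norm, ENNReal.ofReal_pow (norm_nonneg _)]

/-- The real Fourier energy of a slice is the real part of the extended one:
`∫ ∑ₗ ‖V(r, η)ₗ‖² dη = (∫⁻ ∑ₗ ‖V(r, η)ₗ‖ₑ²).toReal` (the integrand is continuous and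
nonnegative). -/
theorem integral_sum_norm_sq_eq_toReal (h : IsFourierMild c K₀ t₀ t₁ V) (r : ℝ) :
    ∫ η, ∑ l, ‖V r η l‖ ^ 2 = (∫⁻ η, ∑ l, ‖V r η l‖ₑ ^ 2).toReal := by
  have hcont : Continuous fun η => ∑ l, ‖V r η l‖ ^ 2 :=
    continuous_finsetSum _ fun l _ =>
      ((continuous_apply l).comp (h.continuous_slice r)).norm.pow 2
  rw [integral_eq_lintegral_of_nonneg_ae
    (Eventually.of_forall fun η => Finset.sum_nonneg fun l _ => sq_nonneg _)
    hcont.aestronglyMeasurable, lintegral_ofReal_sum_norm_sq]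

/-- The extended Fourier energy of a slice of a mild solution is finite (the integrand is
integrable by the decay of the integrable order, `integrable_norm_sq_of_hasDecay`). -/
theorem lintegral_sum_enorm_sq_lt_top (h : IsFourierMild c K₀ t₀ t₁ V) (r : ℝ) :
    ∫⁻ η, ∑ l, ‖V r η l‖ₑ ^ 2 < ⊤ := by
  obtain ⟨A, -, hA⟩ := h.decay₀
  have hint : Integrable (fun η => ∑ l, ‖V r η l‖ ^ 2) :=
    integrable_finsetSum _ fun l _ =>
      integrable_norm_sq_of_hasDecay h.hK₀ ((hA r).apply l)
        ((continuous_apply l).comp (h.continuous_slice r)).aestronglyMeasurable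
  rw [← lintegral_ofReal_sum_norm_sq]
  exact hint.lintegral_lt_top

/-! ### The window step -/

/-- **Window step.** Under uniqueness in the Fourier-mild class of order `4`, for `V` mild of
order `4` on `[t₀, t₁]` with the uniform order-`4` weight `A`, and `s ∈ [t₀, t₁]`,
`s ≤ t ≤ min t₁ (s + T_P)`, `T_P = picardTime c 4 (2A)`: `∫⁻ ∑ₗ‖V(t)ₗ‖ₑ² ≤ ∫⁻ ∑ₗ‖V(s)ₗ‖ₑ²`.
Restart from `V s` (`exists_isTaoSolutionOn_fourierPiece`), identify `V (· + s)` with the Fourier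
side of the restart piece by uniqueness, Plancherel (`lintegral_norm_synthVel_sq_eq`) and the
Leray–Hopf energy inequality of Tao-class solutions (`IsTaoSolutionOn.lintegral_enorm_sq_le`,
`eEnergy_eq_ofReal`). -/
theorem lintegral_energy_le_of_window
    (hU : ∀ (t₀ T T' : ℝ) (V W : ℝ → EuclideanSpace ℝ (Fin 3) → Fin 3 → ℂ),
      IsFourierMild c 4 t₀ T V → IsFourierMild c 4 t₀ T' W → V t₀ = W t₀ →
      ∀ t : ℝ, t₀ ≤ t → t ≤ T → t ≤ T' → V t = W t)
    (h : IsFourierMild c 4 t₀ t₁ V) {A : ℝ} (hA : ∀ r, HasDecay 4 A (V r)) {s t : ℝ}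
    (hs : s ∈ Icc t₀ t₁) (hst : s ≤ t) (ht₁ : t ≤ t₁)
    (htP : t ≤ s + picardTime (Fin 3) c 4 (2 * A)) :
    ∫⁻ η, ∑ l, ‖V t η l‖ₑ ^ 2 ≤ ∫⁻ η, ∑ l, ‖V s η l‖ₑ ^ 2 := by
  have e2 : Fintype.card (Fin 3) + 1 = 4 := by simp
  have hc : 0 < c := h.hc
  have hνpos : 0 < c / (4 * π ^ 2) := by positivity
  have hcν : 4 * π ^ 2 * (c / (4 * π ^ 2)) = c := by field_simp
  have hA0 : 0 ≤ A := (hA s).nonneg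
  set TP : ℝ := picardTime (Fin 3) c 4 (2 * A) with hTP
  have hTPpos : 0 < TP := picardTime_pos hc _ _ (by positivity)
  -- the restart piece from the Fourier-side state `V s`
  have hdecAll : ∀ K : ℕ, ∃ B, HasDecay K B (V s) := fun K => by
    obtain ⟨B, hB⟩ := h.decay K
    exact ⟨B, hB s⟩
  have hdec4 : HasDecay (Fintype.card (Fin 3) + 1) A (V s) := by rw [e2]; exact hA s
  obtain ⟨u, p, W, hTao, hW, hsyn, hW0⟩ := exists_isTaoSolutionOn_fourierPiece hνpos
    (h.continuous_slice s) hdecAll hdec4 (h.divFree s) (h.conjSymm s)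
  rw [e2, hcν, ← hTP] at hTao hW
  -- `V` restarted at `s` is mild on `[0, t₁ - s]`
  have hV' : IsFourierMild c 4 0 (t₁ - s) (fun τ => V (τ + s)) := by
    have h1 := (h.mono hs.1 hs.2 le_rfl).translate (-s)
    simp only [add_neg_cancel, sub_neg_eq_add] at h1
    rwa [← sub_eq_add_neg] at h1
  have h0 : (fun τ : ℝ => V (τ + s)) 0 = W 0 := by
    show V (0 + s) = W 0
    rw [zero_add, hW0]
  -- uniqueness identifies `V` with the Fourier side of the restart piece on the window
  have hVW : V t = W (t - s) := by
    have h1 := hU 0 (t₁ - s) TP (fun τ => V (τ + s)) W hV' hW h0 (t - s) (by linarith)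
      (by linarith) (by linarith)
    simpa only [sub_add_cancel] using h1
  have hWdec : ∀ K : ℕ, ∃ B, HasDecay K B (W (t - s)) := fun K => by
    obtain ⟨B, hB⟩ := hW.decay K
    exact ⟨B, hB (t - s)⟩
  have hmem : MemLp (synthVel (V s)) 2 volume := by
    have h1 := hTao.continuousL2.1 0 ⟨le_rfl, hTPpos.le⟩
    rwa [hTao.initial] at h1
  have hτI : t - s ∈ Icc 0 TP := ⟨by linarith, by linarith⟩
  calc ∫⁻ η, ∑ l, ‖V t η l‖ₑ ^ 2 = ∫⁻ η, ∑ l, ‖W (t - s) η l‖ₑ ^ 2 := by rw [hVW]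
    _ = ∫⁻ x, ‖synthVel (W (t - s)) x‖ₑ ^ 2 :=
        (lintegral_norm_synthVel_sq_eq (W (t - s)) (hW.continuous_slice (t - s)) hWdec
          (hW.conjSymm (t - s))).symm
    _ = ∫⁻ x, ‖u (t - s) x‖ₑ ^ 2 := by rw [hsyn (t - s)]
    _ ≤ ENNReal.ofReal (2 * VectorCalculus.kineticEnergy (synthVel (V s))) :=
        hTao.lintegral_enorm_sq_le hTPpos hνpos.le hτI
    _ = eEnergy (synthVel (V s)) := (eEnergy_eq_ofReal _ hmem).symm
    _ = ∫⁻ x, ‖synthVel (V s) x‖ₑ ^ 2 := rfl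
    _ = ∫⁻ η, ∑ l, ‖V s η l‖ₑ ^ 2 :=
        lintegral_norm_synthVel_sq_eq (V s) (h.continuous_slice s) hdecAll (h.conjSymm s)

/-! ### Chaining the windows -/

/-- **Chaining windows of fixed length.** If a quantity `e : ℝ → ℝ≥0∞` does not increase over any
window `[s, min t₁ (s + T_P)]` starting at `s ∈ [t₀, t₁]` (`T_P > 0` fixed), then `e t ≤ e t₀` on
`[t₀, t₁]` (induction on the number of windows, Archimedes). -/
theorem le_init_of_windows {t₀ t₁ TP : ℝ} (hTP : 0 < TP) (e : ℝ → ℝ≥0∞)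
    (hwin : ∀ s ∈ Icc t₀ t₁, ∀ t, s ≤ t → t ≤ t₁ → t ≤ s + TP → e t ≤ e s) :
    ∀ t ∈ Icc t₀ t₁, e t ≤ e t₀ := by
  have hiter : ∀ n : ℕ, ∀ t ∈ Icc t₀ t₁, t ≤ t₀ + n * TP → e t ≤ e t₀ := by
    intro n
    induction n with
    | zero =>
      intro t ht htn
      simp only [Nat.cast_zero, zero_mul, add_zero] at htn
      rw [le_antisymm htn ht.1]
    | succ n ih =>
      intro t ht htn
      by_cases hle : t ≤ t₀ + n * TP
      · exact ih t ht hle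
      · have hlt : t₀ + n * TP < t := not_le.1 hle
        have hn0 : 0 ≤ (n : ℝ) * TP := by positivity
        have hsI : t₀ + n * TP ∈ Icc t₀ t₁ := ⟨by linarith, by linarith [ht.2]⟩
        have htn' : t ≤ t₀ + n * TP + TP := by push_cast at htn; linarith
        exact (hwin _ hsI t hlt.le ht.2 htn').trans (ih _ hsI le_rfl)
  intro t ht
  obtain ⟨n, hn⟩ := exists_nat_ge ((t₁ - t₀) / TP)
  refine hiter n t ht ?_
  have h1 : t₁ - t₀ ≤ n * TP := by rwa [div_le_iff₀ hTP] at hn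
  linarith [ht.2]

/-! ### The stub -/

/-- **`stub_energyOfUnique`** (crux `EnvelopeBound`, line `registered`): uniqueness in the
Fourier-mild class implies the ENERGY INEQUALITY of Fourier-side mild solutions,
`∫ ∑ₗ ‖V(t)ₗ‖² ≤ ∫ ∑ₗ ‖V(t₀)ₗ‖²` on `[t₀, t₁]` for `IsFourierMild c K₀ t₀ t₁ V` on `ℝ³`. Proof:
order `4` (`isFourierMild_four`), uniform Picard time from the uniform order-`4` weight, the window
step `lintegral_energy_le_of_window` (restart piece `exists_isTaoSolutionOn_fourierPiece` +
uniqueness + Plancherel + Leray–Hopf energy inequality of Tao-class solutions), chained by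
`le_init_of_windows`, and conversion to real integrals (`integral_sum_norm_sq_eq_toReal`,
`lintegral_sum_enorm_sq_lt_top`) (Leray 1934, (2.7)/(3.4); Lemarié-Rieusset 2016, Thm. 7.2,
Prop. 12.1). -/
theorem stub_energyOfUnique :
    (∀ (c : ℝ) (K₀ : ℕ) (t₀ T T' : ℝ)
      (V W : ℝ → EuclideanSpace ℝ (Fin 3) → Fin 3 → ℂ),
      Literature.Analysis.FluidPDE.FourierNS.IsFourierMild c K₀ t₀ T V →
      Literature.Analysis.FluidPDE.FourierNS.IsFourierMild c K₀ t₀ T' W →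
      V t₀ = W t₀ →
      ∀ t : ℝ, t₀ ≤ t → t ≤ T → t ≤ T' → V t = W t) →
    ∀ (c : ℝ) (K₀ : ℕ) (t₀ t₁ : ℝ) (V : ℝ → EuclideanSpace ℝ (Fin 3) → Fin 3 → ℂ),
      Literature.Analysis.FluidPDE.FourierNS.IsFourierMild c K₀ t₀ t₁ V →
      ∀ t ∈ Set.Icc t₀ t₁, ∫ η, ∑ l, ‖V t η l‖ ^ 2 ≤ ∫ η, ∑ l, ‖V t₀ η l‖ ^ 2 := by
  intro hU c K₀ t₀ t₁ V hV t ht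
  have h4 : IsFourierMild c 4 t₀ t₁ V := isFourierMild_four hV
  obtain ⟨A, hA⟩ := hV.decay 4
  have hA0 : 0 ≤ A := (hA t₀).nonneg
  have hTPpos : 0 < picardTime (Fin 3) c 4 (2 * A) := picardTime_pos hV.hc _ _ (by positivity)
  have hle : ∫⁻ η, ∑ l, ‖V t η l‖ₑ ^ 2 ≤ ∫⁻ η, ∑ l, ‖V t₀ η l‖ₑ ^ 2 :=
    le_init_of_windows hTPpos (fun r => ∫⁻ η, ∑ l, ‖V r η l‖ₑ ^ 2)
      (fun s hs r hsr hr₁ hrP =>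
        lintegral_energy_le_of_window (fun t₀' T T' V' W => hU c 4 t₀' T T' V' W) h4 hA hs hsr
          hr₁ hrP) t ht
  rw [integral_sum_norm_sq_eq_toReal hV t, integral_sum_norm_sq_eq_toReal hV t₀]
  exact ENNReal.toReal_mono (lintegral_sum_enorm_sq_lt_top hV t₀).ne hle

end Summit.NavierStokesRegularity.NavierStokesRegularity.Theorems.EnvelopeBound.Registered

end
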